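import Summits.AtomisticToContinuum.HydrodynamicLimit.Theorems.InformationPercolationEngineKickFairRelEquilibriumMesoLongWindowCutAt
import Summits.AtomisticToContinuum.HydrodynamicLimit.Theorems.InformationPercolationEngineKickFairRelEquilibriumMesoLongReductionAt
import Summits.AtomisticToContinuum.HydrodynamicLimit.Theorems.InformationPercolationEngineKickFairRelEquilibriumMesoEquilibriumInputs
import HarnessLib

/-!
# `KickFairRelEquilibriumMeso`, line `kinetic-window-cut` rev 5 — THE EQUILIBRIUM CASE OF THE CRUX FROM ONE PURE DECORRELATION STATEMENT

Prover file (`--supports stmt-AtomisticToContinuum-15177`, lead c8) for the registered sub-goal `equilibriumMesoBody_of_farPairDecorrelationLongConst`: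
along the line's cell sequence `rs N = (N+1)^{-1/4}`,

  `FarPairDecorrelationLongConst rs → EquilibriumMesoBody rs`,

i.e. the body of the crux `KickFairRelEquilibriumMeso` with the data's profiles frozen to constants (the INVARIANT canonical Gibbs law: the
past-weighted, equilibrium-centred kick sum is small in mean, uniformly over admissible weights of the mesoscopic typed past) follows from ONE
statement: far same-window pairs of long-flight kicks, each centred at its own conditional mean, are conditionally uncorrelated given the join of
their typed pasts, in pair-Campbell mean, under the invariant law (`FarPairDecorrelationLongConst`, `…MesoLongWindowDefs`). This is the machine-checked
form of "after rev 5 the equilibrium case hinges on one decorrelation input": the per-profile reduction (`mesoBodyAt_of_long`, p165683) and window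
cut (`truncatedFluctuationLongAt_of_window`, p165718) at constant profiles, fed with B1 trivial (`singleKickBiasAt_const`: β = 0 a.e., p156240), U landed
(`shortFlightLGAt_const` = `shortFlightLG_rung0`, p126384), CPL landed for all profiles (`closePairCountLongAt_const`, p164751) and SWL from pure
decorrelation (`sameWindowPairCovLongAt_const_of_decorrelation`, p163327) — all four packaged in `…MesoEquilibriumInputs` (p165712). No count input, no
`LG → G` transfer, no index truncation remains; the pair-Campbell second-moment wall of rev 3 is gone.
-/

noncomputable section

namespace Summit.AtomisticToContinuum.HydrodynamicLimit.Theorems.KickFairRelEquilibriumMesoLine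

/-- **THE EQUILIBRIUM BODY OF THE CRUX FROM FAR-PAIR DECORRELATION ALONE** (registered sub-goal of the line `kinetic-window-cut`, rev 5):
`FarPairDecorrelationLongConst rs → EquilibriumMesoBody rs`. For constant profiles `(a, θ, u)`, `a, θ > 0`: the per-profile reduction
`mesoBodyAt_of_long` applied to `singleKickBiasAt_const` (B1 trivial at equilibrium), `shortFlightLGAt_const` (U landed at equilibrium) and the per-profile
window cut `truncatedFluctuationLongAt_of_window` fed with `sameWindowPairCovLongAt_const_of_decorrelation hF` (SWL from the hypothesis) and
`closePairCountLongAt_const` (CPL landed). [folklore] -/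
theorem equilibriumMesoBody_of_farPairDecorrelationLongConst : FarPairDecorrelationLongConst rs → EquilibriumMesoBody rs :=
  fun hF a θ u ha hθ =>
    mesoBodyAt_of_long (fun _ => a) (fun _ => θ) (fun _ => u) continuous_const continuous_const continuous_const
      (fun _ => ha) (fun _ => hθ) (singleKickBiasAt_const a θ u ha hθ) (shortFlightLGAt_const a θ u ha hθ)
      (truncatedFluctuationLongAt_of_window (fun _ => a) (fun _ => θ) (fun _ => u) continuous_const continuous_const
        continuous_const (fun _ => ha) (fun _ => hθ) (sameWindowPairCovLongAt_const_of_decorrelation hF a θ u ha hθ)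
        (closePairCountLongAt_const a θ u ha hθ))

end Summit.AtomisticToContinuum.HydrodynamicLimit.Theorems.KickFairRelEquilibriumMesoLine

end
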